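import Summits.BirchSwinnertonDyer.BirchSwinnertonDyer.Theorems.EisensteinPrimesGoodLatticeQuotCharUnramified
import Summits.BirchSwinnertonDyer.Rank1Residual.X1.AnomalousReduction
import Literature.NumberTheory.EllipticCurves.GoodReductionUnramifiedProofs
import Literature.NumberTheory.EllipticCurves.SerreOpenImageOrdinaryInertiaProofs
import Literature.NumberTheory.EllipticCurves.TateModuleWildKernelProofs
import Literature.NumberTheory.EllipticCurves.Rank1Residual.Predicates
import HarnessLib

/-!
# Route `EisensteinPrimes` (rung K5), crux 2 `GoodLatticeBDPValue`, line `halves`, stub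
# `stub_muLambda`: the quotient character `𝟙̃` of a RAMIFIED rational `p`-line is UNRAMIFIED AT `p`
# at a good ORDINARY prime — the étale-quotient input [LOCp], IN THE KERNEL

Cell `bsd-eis` (FULL-BSD rank-≤1 programme, `run/shared/lean/pub/bsd-eis/`), seat `bsd-eis-k5-c2`
(D-0074 group (C) row A). In the kernel split of `stub_muLambda` (HOME/k5-c2-MEMO-1.md; shapes file
`X1/KellerYinMuLambdaSplit.lean` v3) the displayed PUBLISHED input [LOCp]
(`GoodLatticeQuotCharUnramifiedAtPOnTree`) says: for `E/ℚ` at a good anomalous prime `p` with the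
good-lattice normalisation, every rational `p`-line `Φ` being RAMIFIED at `p`, the Teichmüller lift
`θ : G_ℚ → GL₁(𝓞)` of the character on `E[p]/Φ` is UNRAMIFIED at `p` ("`φ|_{G_p} = ω` (so
`ψ|_{G_p} = 𝟙`)", KY Prop. 1.3.1 / §1.4; Silverman VII §2–3). This file PROVES it, for any globally
minimal `E/ℚ` with good ORDINARY reduction at `p` (`p ∤ a_p`; anomalous `a_p ≡ 1` is a special case):

* `smul_sub_mem_of_mem_inertia_of_not_lineUnramifiedAt` (the core): for every prime `𝔓 ∣ p` of
  `\bar ℤ`, every `τ` in the inertia group `I_𝔓 ≤ G_ℚ` and every `P ∈ E[p](ℚ̄)`: `τP − P ∈ Φ`.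
  PROOF. Lift `τ` to the local inertia group at a prime `𝔐` of `\bar ℤ_p` along an embedding
  `ι : ℚ̄ → ℚ̄_p` cutting out `𝔓` (tree: `exists_mem_inertia_apply_eq_holds`,
  `exists_smul_eq_of_mem_primesAbove_holds`, the glue of `GoodReductionUnramifiedProofs`); local
  inertia does not change reductions (`X2.GreenbergVatsalReductionDatum.localRed_smul_of_mem_absInertia`),
  so `ι_*(τP − P)` lies in `ker red ∩ E[p] = ⟨P₁⟩`, cyclic of order `p` at an ORDINARY prime
  (`localRed_ordinary_filtration`, the ordinary point from `exists_zsmul_eq_zero_localRed_ne_zero`).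
  The ramification of `Φ` at `p` — at ANY `𝔓 ∣ p`, by conjugation (`Ideal.conj_mem_inertia_smul_iff`,
  transitivity on primes) — gives `τ₀ ∈ I_𝔓`, `P₀ ∈ Φ` with `D = τ₀P₀ − P₀ ∈ Φ ∖ 0`, hence
  `ι_*D = c₀P₁` with `p ∤ c₀`: so `⟨P₁⟩ = ι_*(Φ)` and `τP − P = kD ∈ Φ` (`ι_*` injective).
* `apply_eq_one_of_forall_smul_sub_mem` — if a Teichmüller lift `θ` of the action on `E[p]/Φ`
  (`IsTeichmullerLiftOnQuot`, p419246) sees `τP − P ∈ Φ` for all `P ∈ E[p]`, then `θ(τ) = 1`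
  (`#E[p] = p² > #Φ`, Teichmüller rigidity — the tree lemmas of p425660).
* `isUnramifiedAt_of_isTeichmullerLiftOnQuot_of_not_lineUnramifiedAt` — [LOCp] for good ordinary `p`;
  `goodLatticeQuotCharUnramifiedAtPOnTree_holds'`-shaped corollary at a good ANOMALOUS prime
  (`a_p ≡ 1 (mod p)` forces `p ∤ a_p`), i.e. exactly the binders of the displayed input, which the
  composition file can now DISCHARGE.

THEOREMS ONLY; no `def`, no named fact; nothing asserted about any particular curve; helper
attached to stmt-BirchSwinnertonDyer-19032 (`--supports`, no stub credit).

References: [SilvermanAEC2009] VII.§2–3 (reduction, `E₁`, the ordinary filtration), Prop. VII.4.1;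
[GreenbergLNM1716] §1 p. 62 (`0 → ℱ[p^∞] → E[p^∞] → Ẽ[p^∞] → 0`); [KellerYin2024] Prop. 1.3.1,
§1.4 (arXiv:2402.12781v2 TeX L877, L1063–1087); [NeukirchANT1999] I §9 (9.4), II §9 (9.6).
-/

set_option autoImplicit false
set_option linter.dupNamespace false

noncomputable section

open scoped Classical NNReal Pointwise

universe u

open NumberField IsDedekindDomain Field IsDedekindDomain.HeightOneSpectrum WeierstrassCurve
  Rat.HeightOneSpectrum
  Literature.NumberTheory.EllipticCurves Literature.NumberTheory.GaloisRepresentations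
  Literature.NumberTheory.EllipticCurves.KellerYin2024 Literature.NumberTheory.EllipticCurves.Rank1Residual
  Summit.BirchSwinnertonDyer.Rank1Residual.X2.GreenbergVatsalReductionDatum
  Summit.BirchSwinnertonDyer.Rank1Residual.Additive

namespace Summit.BirchSwinnertonDyer.BirchSwinnertonDyer.Theorems.EisensteinPrimesMuLambda

/-! ## §1 The kernel line of reduction at a good ordinary prime (local) -/

section Local

variable (W : WeierstrassCurve ℚ) [W.IsElliptic] [W.IsGloballyMinimal] (p : ℕ) [hp : Fact p.Prime]
  {v : HeightOneSpectrum (𝓞 ℚ)}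

/-- **The kernel line `ker red_v ∩ E[p] = ⟨P₁⟩` at a good ORDINARY prime** (the layer `r = 1` of the
tree's ordinary filtration `localRed_ordinary_filtration`, with the ordinary point of
`exists_zsmul_eq_zero_localRed_ne_zero`): there is `P₁ ∈ E(K̄_v)` of order `p` with `red P₁ = 0`
such that every `p`-torsion point with trivial reduction is a multiple of `P₁`.
[cite: GreenbergLNM1716, §1 p. 62] [cite: SilvermanAEC2009, Prop. VII.2.1 and VII.§3] -/
theorem exists_generator_ker_localRed_torsion (hpv : ((p : ℕ) : 𝓞 ℚ) ∈ v.asIdeal)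
    (hΔ : ¬ (p : ℤ) ∣ minimalDiscriminantInt W) (hord : ¬ (p : ℤ) ∣ W.frobeniusTrace p) :
    ∃ P₁ : localPoints W (v.adicCompletion ℚ), localRed W p hpv hΔ P₁ = 0 ∧ addOrderOf P₁ = p ∧
      ∀ Q : localPoints W (v.adicCompletion ℚ), localRed W p hpv hΔ Q = 0 → (p : ℤ) • Q = 0 →
        ∃ c : ℕ, Q = c • P₁ := by
  have hw := specVal_spec v
  have hΔu : IsUnit ((integralModelInt W).map (algebraMap ℤ ↥(specVal v).valuationSubring)).Δ :=
    isUnit_Δ_localIntModel W hpv hw hΔ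
  haveI hcharw : CharP (IsLocalRing.ResidueField ((specVal v).valuationSubring)) p :=
    GoodModelLine.charP_residueField_specVal p hpv
  have hordA := W.exists_zsmul_eq_zero_localRed_ne_zero hw hΔu (localRed W p hpv hΔ)
    (localRed_apply W p hpv hΔ) hpv hΔ hord
  obtain ⟨hgen, -, -⟩ := W.localRed_ordinary_filtration hΔu (localRed W p hpv hΔ)
    (localRed_apply W p hpv hΔ) hordA
  obtain ⟨P₁, hP₁, hord₁, hmult⟩ := hgen 1
  refine ⟨P₁, hP₁, by rw [hord₁, pow_one], fun Q hQ hpQ ↦ hmult Q hQ ?_⟩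
  rw [pow_one]
  exact hpQ

omit [W.IsElliptic] [W.IsGloballyMinimal] in
/-- Multiples of a point of order `p` only depend on the residue mod `p`. [folklore] -/
theorem nsmul_eq_nsmul_of_natCast_eq {P₁ : localPoints W (v.adicCompletion ℚ)} (hord₁ : addOrderOf P₁ = p)
    {a b : ℕ} (h : (a : ZMod p) = (b : ZMod p)) : a • P₁ = b • P₁ := by
  rw [ZMod.natCast_eq_natCast_iff'] at h
  have hmod : ∀ n : ℕ, n • P₁ = (n % p) • P₁ := fun n ↦ by
    conv_lhs => rw [← Nat.div_add_mod n p, add_nsmul]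
    rw [addOrderOf_dvd_iff_nsmul_eq_zero.mp (by rw [hord₁]; exact Dvd.intro _ rfl), zero_add]
  rw [hmod a, hmod b, h]

end Local

/-! ## §2 The core: inertia-generated differences lie in the ramified rational line -/

section Global

variable (W : WeierstrassCurve ℚ) [W.IsElliptic] [W.IsGloballyMinimal] (p : ℕ) [hp : Fact p.Prime]

/-- **The core of [LOCp].** For a globally minimal `E/ℚ` with good ORDINARY reduction at `p`, a
rational `p`-line `Φ` RAMIFIED at `p`, a prime `𝔓 ∣ p` of `\bar ℤ`, `τ ∈ I_𝔓` and `P ∈ E[p](ℚ̄)`: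
`τP − P ∈ Φ`. (Local inertia fixes reductions; `ker red ∩ E[p]` is the cyclic group of order `p`
generated by the formal-group `p`-torsion; it contains a non-zero element of `Φ` because `Φ` is
inertia-stable and ramified; hence it IS `Φ` read in `E(K̄_p)`.) [cite: SilvermanAEC2009, VII.§2–3 and Prop. VII.4.1]
[cite: GreenbergLNM1716, §1 p. 62] [cite: NeukirchANT1999, Ch. I §9 (9.4), Ch. II §9 (9.6)] -/
theorem smul_sub_mem_of_mem_inertia_of_not_lineUnramifiedAt (hgood : W.HasGoodReductionAtPrime p)
    (hord : ¬ (p : ℤ) ∣ W.frobeniusTrace p) {Φ : AddSubgroup (geomTorsion W (p : ℤ))}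
    (hΦ : IsRationalLine W p Φ) (hram : ¬ LineUnramifiedAt W p Φ)
    {u : HeightOneSpectrum (𝓞 ℚ)} (hu : ((p : ℕ) : 𝓞 ℚ) ∈ u.asIdeal)
    {𝔓 : Ideal (absIntegers (𝓞 ℚ) ℚ)} (h𝔓 : 𝔓 ∈ u.primesAbove)
    {τ : absoluteGaloisGroup ℚ} (hτ : τ ∈ 𝔓.inertia (absoluteGaloisGroup ℚ))
    {P : geomPoints W} (hP : P ∈ geomTorsion W (p : ℤ)) :
    τ • P - P ∈ Φ.map (geomTorsion W (p : ℤ)).subtype := by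
  have hΔ : ¬ (p : ℤ) ∣ minimalDiscriminantInt W :=
    W.not_dvd_minimalDiscriminantInt_of_hasGoodReductionAtPrime' p hgood
  obtain ⟨-, hstab⟩ := hΦ
  -- stability of `Φ` read in `E(ℚ̄)` and of `E[p]`
  have hΦ₁stab : ∀ σ : absoluteGaloisGroup ℚ, ∀ R ∈ Φ.map (geomTorsion W (p : ℤ)).subtype,
      σ • R ∈ Φ.map (geomTorsion W (p : ℤ)).subtype := by
    rintro σ _ ⟨R, hRmem, rfl⟩
    exact ⟨σ • R, hstab σ R hRmem, rfl⟩
  have hTstab : ∀ σ : absoluteGaloisGroup ℚ, ∀ R ∈ geomTorsion W (p : ℤ), σ • R ∈ geomTorsion W (p : ℤ) :=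
    fun σ R hR ↦ by
    rw [mem_geomTorsion_iff] at hR ⊢
    rw [smul_comm, hR, smul_zero]
  -- §a the local frame: the standard embedding `ι : ℚ̄ → ℚ̄_u`, a prime `𝔐` of `\bar ℤ_u` and the
  -- prime `𝔓' = 𝔓_{ι,𝔐}` of `\bar ℤ` it cuts out; `𝔓 = g • 𝔓'`
  obtain ⟨𝔐, h𝔐⟩ := u.localPrimesAbove_nonempty
  set ι : AlgebraicClosure ℚ →ₐ[ℚ] AlgebraicClosure (u.adicCompletion ℚ) :=
    closureEmb (K := ℚ) (u.adicCompletion ℚ) with hι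
  have h𝔓' : u.primeBelow ι 𝔐 ∈ u.primesAbove := HeightOneSpectrum.primeBelow_mem_primesAbove h𝔐
  obtain ⟨g, hg⟩ := HeightOneSpectrum.exists_smul_eq_of_mem_primesAbove_holds h𝔓' h𝔓
  -- §b the kernel line `⟨P₁⟩ = ker red ∩ E[p]` and the transport of inertia differences into it
  obtain ⟨P₁, -, hord₁, hmult⟩ := exists_generator_ker_localRed_torsion W p hu hΔ hord
  have key : ∀ {ρ : absoluteGaloisGroup ℚ}, ρ ∈ (u.primeBelow ι 𝔐).inertia (absoluteGaloisGroup ℚ) →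
      ∀ {R : geomPoints W}, R ∈ geomTorsion W (p : ℤ) →
        ∃ c : ℕ, pointsMapOfEmb W ι (ρ • R - R) = c • P₁ := by
    intro ρ hρ R hR
    obtain ⟨σ, hσI, hσ⟩ :=
      IsDedekindDomain.HeightOneSpectrum.exists_mem_inertia_apply_eq_holds u ι h𝔐 hρ
    have hres : resGalOfEmb ι σ = ρ := resGalOfEmb_eq_of_apply_eq ι hσ
    have hσabs : σ ∈ absInertia (u.adicCompletion ℚ) := by
      rw [← inertia_eq_absInertia (specVal_spec u) h𝔐]; exact hσI
    have hequiv : pointsMapOfEmb W ι (ρ • R) = σ • pointsMapOfEmb W ι R := by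
      rw [← hres]
      exact pointsMapOfEmb_smul W ι σ R
    refine hmult _ ?_ ?_
    · rw [map_sub, hequiv, map_sub, localRed_smul_of_mem_absInertia W p hu hΔ hσabs, sub_self]
    · rw [← map_zsmul, smul_sub, smul_comm, (mem_geomTorsion_iff W _ R).mp hR, smul_zero, sub_self,
        map_zero]
  -- §c ramification of `Φ` at `𝔓'`: some `τ₀ ∈ I_{𝔓'}`, `P₀ ∈ Φ` with `τ₀P₀ ≠ P₀`
  obtain ⟨τ₀, hτ₀, P₀, hP₀Φ, hne⟩ : ∃ τ₀ ∈ (u.primeBelow ι 𝔐).inertia (absoluteGaloisGroup ℚ),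
      ∃ P₀ ∈ Φ, τ₀ • P₀ ≠ P₀ := by
    simp only [LineUnramifiedAt, not_forall, exists_prop] at hram
    obtain ⟨v₀, hv₀, 𝔓₀, h𝔓₀, σ₀, hσ₀, P₀, hP₀, hne₀⟩ := hram
    -- `ℚ` has one place above `p` (cf. `X2.TrivialZeroQuotient.eq_of_natCast_mem`)
    have huv : v₀ = u := by
      rw [(natCast_mem_asIdeal_iff_eq_primesEquiv_symm v₀ hp.out).mp hv₀,
        (natCast_mem_asIdeal_iff_eq_primesEquiv_symm u hp.out).mp hu]
    subst huv
    obtain ⟨g₀, hg₀⟩ := HeightOneSpectrum.exists_smul_eq_of_mem_primesAbove_holds h𝔓₀ h𝔓'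
    refine ⟨g₀ * σ₀ * g₀⁻¹, ?_, g₀ • P₀, hstab g₀ P₀ hP₀, ?_⟩
    · rw [← hg₀]; exact (Ideal.conj_mem_inertia_smul_iff 𝔓₀ g₀ σ₀).mpr hσ₀
    · rw [mul_smul, mul_smul, inv_smul_smul]
      exact fun h ↦ hne₀ (MulAction.injective g₀ h)
  -- `D = τ₀P₀ − P₀ ∈ Φ ∖ 0`, read in `E(ℚ̄)`
  set D : geomPoints W := ((τ₀ • P₀ : geomTorsion W (p : ℤ)) : geomPoints W) - (P₀ : geomPoints W)
    with hDdef
  have hDmem : D ∈ Φ.map (geomTorsion W (p : ℤ)).subtype :=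
    ⟨τ₀ • P₀ - P₀, Φ.sub_mem (hstab τ₀ P₀ hP₀Φ) hP₀Φ, by rw [map_sub]; rfl⟩
  have hD0 : D ≠ 0 := by
    intro h
    apply hne
    rw [hDdef, sub_eq_zero] at h
    exact Subtype.ext h
  have hDeq : D = τ₀ • (P₀ : geomPoints W) - (P₀ : geomPoints W) := by
    rw [hDdef, AddSubgroup.torsionBy.coe_smul]
  -- `ι_* D = c₀ • P₁` with `c₀` a unit mod `p`
  obtain ⟨c₀, hc₀⟩ := key hτ₀ (R := (P₀ : geomPoints W)) P₀.2
  rw [← hDeq] at hc₀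
  have hc₀0 : (c₀ : ZMod p) ≠ 0 := by
    intro h0
    apply hD0
    apply pointsMapOfEmb_injective W ι
    rw [map_zero, hc₀, nsmul_eq_nsmul_of_natCast_eq W p hord₁
      (show ((c₀ : ℕ) : ZMod p) = ((0 : ℕ) : ZMod p) by rw [h0, Nat.cast_zero]), zero_nsmul]
  -- §d the given `τ ∈ I_𝔓 = I_{g • 𝔓'}`: move to `τ' = g⁻¹ τ g ∈ I_{𝔓'}` and `P' = g⁻¹ P`
  have hτ' : g⁻¹ * τ * g ∈ (u.primeBelow ι 𝔐).inertia (absoluteGaloisGroup ℚ) := by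
    rw [← mem_inertia_smul_iff_conj_mem, hg]; exact hτ
  have hP' : g⁻¹ • P ∈ geomTorsion W (p : ℤ) := hTstab _ P hP
  obtain ⟨c, hc⟩ := key hτ' hP'
  set k : ℕ := ((c : ZMod p) * (c₀ : ZMod p)⁻¹).val with hk
  have hkc : ((k * c₀ : ℕ) : ZMod p) = (c : ZMod p) := by
    rw [Nat.cast_mul, hk, ZMod.natCast_zmod_val, mul_assoc, inv_mul_cancel₀ hc₀0, mul_one]
  have heq : pointsMapOfEmb W ι ((g⁻¹ * τ * g) • (g⁻¹ • P) - g⁻¹ • P) = pointsMapOfEmb W ι (k • D) := by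
    rw [hc, map_nsmul, hc₀, ← mul_smul, nsmul_eq_nsmul_of_natCast_eq W p hord₁ hkc]
  have hmem' : (g⁻¹ * τ * g) • (g⁻¹ • P) - g⁻¹ • P ∈ Φ.map (geomTorsion W (p : ℤ)).subtype := by
    rw [pointsMapOfEmb_injective W ι heq]
    exact AddSubgroup.nsmul_mem _ hDmem k
  -- back to `τ`, `P`: `τP − P = g • (τ'P' − P')`
  have e : τ • P - P = g • ((g⁻¹ * τ * g) • (g⁻¹ • P) - g⁻¹ • P) := by
    rw [mul_smul, mul_smul, smul_inv_smul, smul_sub, smul_inv_smul, ← mul_smul, mul_inv_cancel, one_smul]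
  rw [e]
  exact hΦ₁stab g _ hmem'

end Global

/-! ## §3 From `τP − P ∈ Φ` to `θ(τ) = 1`, and [LOCp] -/

section Conclusion

variable {p : ℕ} [hp : Fact p.Prime]

/-- `‖a − 1‖ < 1` in `ℚ̄_p` for an integer `a ≡ 1 (mod p)`. [folklore] -/
theorem norm_intCast_sub_one_lt_one_of_dvd {a : ℤ} (h : (p : ℤ) ∣ a - 1) :
    ‖(a : PadicAlgCl p) - 1‖ < 1 := by
  rw [show (a : PadicAlgCl p) - 1 = (((a - 1 : ℤ) : ℚ_[p]) : PadicAlgCl p) by push_cast; rfl,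
    PadicAlgCl.norm_extends]
  exact Padic.norm_intCast_lt_one_iff.mpr h

end Conclusion

section Curve

variable {K : Type} [Field K] [NumberField K] (WK : WeierstrassCurve K) [WK.IsElliptic]
  {p : ℕ} [hp : Fact p.Prime] (S : Set (PadicAlgCl p))

/-- **`θ(τ) = 1` when `τ` acts trivially on `E[p]/Φ`.** For an elliptic curve over a number field
`K`, `Φ ≤ E(K̄)` of order `p`, a Teichmüller lift `θ : Γ_K → GL₁(𝓞)` of the action of `Γ_K` on
`E[p]/Φ` (`IsTeichmullerLiftOnQuot`) and `τ ∈ Γ_K` with `τP − P ∈ Φ` for all `P ∈ E[p]`: `θ(τ) = 1`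
(the integer `a ≡ θ(τ)` of the predicate has `(a − 1)P ∈ Φ` on `E[p]`, so `p ∣ a − 1` as
`#E[p] = p² > p`; Teichmüller rigidity). [cite: KellerYin2024, §1.4 (arXiv:2402.12781v2 TeX L1063–1086)]
[cite: LangCyclotomic1990, Ch. 1 §2] -/
theorem apply_eq_one_of_forall_smul_sub_mem {Φ : AddSubgroup (geomPoints WK)} (hcard : Nat.card Φ = p)
    {θ : FramedGaloisRep K (padicCoeffIntegers S) 1}
    (hθ : IsTeichmullerLiftOnQuot S Φ (geomTorsion WK (p : ℤ)) θ) {τ : absoluteGaloisGroup K}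
    (hτ : ∀ P ∈ geomTorsion WK (p : ℤ), τ • P - P ∈ Φ) : θ τ = 1 := by
  obtain ⟨a, ha, hΦ⟩ := hθ.2 τ
  obtain ⟨P, hP, hPΦ⟩ := exists_mem_geomTorsion_notMem WK (p := p) hcard
  have h1a : (a - 1) • P ∈ Φ := by
    have e : (a - 1) • P = (τ • P - P) - (τ • P - a • P) := by rw [sub_smul, one_smul]; abel
    rw [e]
    exact Φ.sub_mem (hτ P hP) (hΦ P hP)
  have hdvd : (p : ℤ) ∣ a - 1 := prime_dvd_of_zsmul_mem WK hP hPΦ h1a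
  have he1 : ‖((entry S θ τ : padicCoeffIntegers S) : PadicAlgCl p) - 1‖ < 1 := by
    have e : ((entry S θ τ : padicCoeffIntegers S) : PadicAlgCl p) - 1 =
        (((entry S θ τ : padicCoeffIntegers S) : PadicAlgCl p) - a) + ((a : PadicAlgCl p) - 1) := by
      ring
    rw [e]
    exact (IsUltrametricDist.norm_add_le_max _ _).trans_lt
      (max_lt ha (norm_intCast_sub_one_lt_one_of_dvd hdvd))
  have hpow : ((entry S θ τ : padicCoeffIntegers S) : PadicAlgCl p) ^ (p - 1) = 1 := by
    have h := congrArg ((↑) : padicCoeffIntegers S → PadicAlgCl p)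
      (entry_pow_eq_one_of_pow_eq_one S θ τ (hθ.1 τ))
    push_cast at h
    exact h
  exact apply_eq_one_of_entry_eq_one S θ τ
    (Subtype.ext (eq_one_of_pow_eq_one_of_norm_sub_one_lt_one hpow he1))

end Curve

section AtP

variable (W : WeierstrassCurve ℚ) [W.IsElliptic] [W.IsGloballyMinimal] (p : ℕ) [hp : Fact p.Prime]
  (S : Set (PadicAlgCl p))

/-- **[LOCp] at a good ORDINARY prime.** For a globally minimal `E/ℚ` with good ordinary reduction
at `p` (`p ∤ a_p`), a rational `p`-line `Φ` RAMIFIED at `p`, and a Teichmüller lift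
`θ : G_ℚ → GL₁(𝓞)` of the character of `G_ℚ` on `E[p]/Φ`: `θ` is UNRAMIFIED at `p` — every inertia
group `I_𝔓`, `𝔓 ∣ p`, maps to `1` (`smul_sub_mem_of_mem_inertia_of_not_lineUnramifiedAt` +
`apply_eq_one_of_forall_smul_sub_mem`). "`φ|_{G_p} = ω` (so `ψ|_{G_p} = 𝟙`)".
[cite: KellerYin2024, Prop. 1.3.1 and §1.4 (arXiv:2402.12781v2 TeX L877, L1087)]
[cite: SilvermanAEC2009, VII.§2–3, Prop. VII.4.1] [cite: GreenbergLNM1716, §1 p. 62] -/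
theorem isUnramifiedAt_of_isTeichmullerLiftOnQuot_of_not_lineUnramifiedAt
    (hgood : W.HasGoodReductionAtPrime p) (hord : ¬ (p : ℤ) ∣ W.frobeniusTrace p)
    {Φ : AddSubgroup (geomTorsion W (p : ℤ))} (hΦ : IsRationalLine W p Φ) (hram : ¬ LineUnramifiedAt W p Φ)
    {θ : FramedGaloisRep ℚ (padicCoeffIntegers S) 1}
    (hθ : IsTeichmullerLiftOnQuot S (Φ.map (geomTorsion W (p : ℤ)).subtype) (geomTorsion W (p : ℤ)) θ)
    (u : HeightOneSpectrum (𝓞 ℚ)) (hu : ((p : ℕ) : 𝓞 ℚ) ∈ u.asIdeal) : θ.IsUnramifiedAt u := by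
  intro 𝔓 h𝔓 τ hτ
  have hcardΦ : Nat.card (Φ.map (geomTorsion W (p : ℤ)).subtype) = p := by
    rw [Nat.card_congr (Φ.equivMapOfInjective (geomTorsion W (p : ℤ)).subtype
      (geomTorsion W (p : ℤ)).subtype_injective).toEquiv.symm, hΦ.1]
  exact apply_eq_one_of_forall_smul_sub_mem W S hcardΦ hθ fun P hP ↦
    smul_sub_mem_of_mem_inertia_of_not_lineUnramifiedAt W p hgood hord hΦ hram hu h𝔓 hτ hP

/-- **[LOCp] with the binders of the displayed input `GoodLatticeQuotCharUnramifiedAtPOnTree`**: at a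
good ANOMALOUS Eisenstein prime `p > 2` (`a_p ≡ 1 (mod p)`, hence `p ∤ a_p`: ordinary) with the
good-lattice normalisation (every rational `p`-line is ramified at `p`), for every rational `p`-line
`Φ` and every Teichmüller lift `θ` of the character on `E[p]/Φ`, `θ` is unramified at the place
above `p`. [cite: KellerYin2024, Prop. 1.3.1 and §1.4 (arXiv:2402.12781v2 TeX L877, L1087)]
[cite: SilvermanAEC2009, VII.§2–3] -/
theorem isUnramifiedAt_quotChar_of_anom (_hp2 : 2 < p) (hgood : Good W p) (_hred : Red W p)
    (hanom : Anom W p)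
    (hGL : ∀ Φ : AddSubgroup (geomTorsion W (p : ℤ)), IsRationalLine W p Φ → ¬ LineUnramifiedAt W p Φ)
    (Φ : AddSubgroup (geomTorsion W (p : ℤ))) (hΦ : IsRationalLine W p Φ)
    (θ : FramedGaloisRep ℚ (padicCoeffIntegers S) 1)
    (hθ : IsTeichmullerLiftOnQuot S (Φ.map (geomTorsion W (p : ℤ)).subtype) (geomTorsion W (p : ℤ)) θ)
    (u : HeightOneSpectrum (𝓞 ℚ)) (hu : ((p : ℕ) : 𝓞 ℚ) ∈ u.asIdeal) : θ.IsUnramifiedAt u := by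
  have hord : ¬ (p : ℤ) ∣ W.frobeniusTrace p := by
    intro h
    have h1 : (p : ℤ) ∣ 1 := by
      have := (Int.dvd_sub h hanom.2.2)
      rwa [sub_sub_cancel] at this
    have hp1 := hp.out.one_lt
    have := Int.le_of_dvd one_pos h1
    omega
  exact isUnramifiedAt_of_isTeichmullerLiftOnQuot_of_not_lineUnramifiedAt W p S hgood hord hΦ (hGL Φ hΦ)
    hθ u hu

end AtP

end Summit.BirchSwinnertonDyer.BirchSwinnertonDyer.Theorems.EisensteinPrimesMuLambda

end
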